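import Mathlib
import HarnessLib
import Summits.ValiantsHypothesis.ValiantsHypothesis.Theses.MonotoneRestoration
import Literature.Computability.AlgebraicComplexity.ArithCircuit
import Literature.Computability.AlgebraicComplexity.ArithCircuitProofs
import Literature.Computability.AlgebraicComplexity.MonotoneStructure
import Literature.Computability.AlgebraicComplexity.PermanentIrreducible
import Literature.ModelTheory.FiniteModelTheory.CkEquiv
import Summits.ValiantsHypothesis.ValiantsHypothesis.Theorems.MonotoneRestorationMonotoneRestorationQPCosetCount
import Summits.ValiantsHypothesis.ValiantsHypothesis.Theorems.MonotoneRestorationMonotoneRestorationQPSymmetricLB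
import Summits.ValiantsHypothesis.ValiantsHypothesis.Theorems.MonotoneRestorationMonotoneRestorationQPSupportSymmetrisation
import Summits.ValiantsHypothesis.ValiantsHypothesis.Theorems.MonotoneRestorationMonotoneRestorationQPSparseRegime
import Summits.ValiantsHypothesis.ValiantsHypothesis.Theorems.MonotoneRestorationMonotoneRestorationQPBeta
import Literature.Computability.AlgebraicComplexity.SymmetricArithCircuit
import Literature.Computability.AlgebraicComplexity.DawarWilsenach2025Proofs
import Literature.GroupTheory.PermutationGroups.SmallIndexSubgroups
import Summits.ValiantsHypothesis.ValiantsHypothesis.Theorems.MonotoneRestorationQP.Negative.LoadBearing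
import Summits.ValiantsHypothesis.ValiantsHypothesis.Theorems.MonotoneRestorationMonotoneRestorationQPPermSupportCount
import Summits.ValiantsHypothesis.ValiantsHypothesis.Theorems.MonotoneRestorationMonotoneRestorationQPMonotoneComputationOfComplexity
import Literature.Barriers.ValiantsHypothesis.MonotoneGapPermanentLower

/-! TTRL-lite variant V19033 of stmt-ValiantsHypothesis-15886 -/

set_option linter.dupNamespace false

namespace Summit.ValiantsHypothesis.ValiantsHypothesis.Theorems

open Summit.ValiantsHypothesis.ValiantsHypothesis.Theses.MonotoneRestoration
open Literature.Computability.AlgebraicComplexity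

/-- TTRL-lite variant V19033 (`specialise`: `σ := Fin n × Fin n`, `f := per_n`) of
`stub_monotoneComputation_of_complexity` (stmt-ValiantsHypothesis-15886): the Jerrum–Snir lower
bound `n (2^{n-1} - 1) ≤ ⊗`-count of any monotone computation of the `n × n` permanent over `ℝ≥0`
(`JerrumSnir.le_prodCount_perPoly`) transfers, via `prodCount ≤ size` and the size-`3 · complexity`
monotone computation of `stub_monotoneComputation_of_complexity`, to the plain circuit complexity:
`n (2^{n-1} - 1) ≤ 3 · complexity (per_n)` over `ℝ≥0`. [cite: JerrumSnir1982, §2.2 and §4.3] -/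
theorem stub_monotoneComputation_of_complexity_var19033 :
    ∀ (n : ℕ), 1 ≤ n → n * (2 ^ (n - 1) - 1) ≤ 3 * complexity (perPoly (Fin n) NNReal) := by
  intro n hn
  obtain ⟨P, hP, hsize⟩ := stub_monotoneComputation_of_complexity (perPoly (Fin n) NNReal)
  calc n * (2 ^ (n - 1) - 1)
      ≤ Literature.Barriers.ValiantsHypothesis.prodCount P :=
        Literature.Barriers.ValiantsHypothesis.JerrumSnir.le_prodCount_perPoly hn hP
    _ ≤ P.size := Literature.Barriers.ValiantsHypothesis.prodCount_le_size P
    _ ≤ 3 * complexity (perPoly (Fin n) NNReal) := hsize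

end Summit.ValiantsHypothesis.ValiantsHypothesis.Theorems
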